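import Summits.BirchSwinnertonDyer.BirchSwinnertonDyer.Theorems.ByReductionTypeAtTwoOrdKatoHalfAtTwoIsoKolyvaginRankOneTwo
import Summits.BirchSwinnertonDyer.BirchSwinnertonDyer.Theorems.ByReductionTypeAtTwoOrdKatoHalfAtTwoIsoKolyvaginPackageTwoReal
import Summits.BirchSwinnertonDyer.BirchSwinnertonDyer.Theorems.ByReductionTypeAtTwoOrdKatoHalfAtTwoIsoStepFourOfXInf
import HarnessLib

/-!
# Route ByReductionTypeAtTwo, crux `OrdKatoHalfAtTwoIso` (stmt-BirchSwinnertonDyer-19573), line `steinberg-fibre-at-two`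
# (skeleton v11), child `OrdKatoIntSurjectiveAtTwo` = CoreA⁺ `CoreTheoremAPosDiscTwo` (stmt-BirchSwinnertonDyer-23967):
# plan item (P4)-a of the lead's `STUB-BRIEF-stub_coreA_posDisc.md` — (H-K)⁺, KOLYVAGIN'S CLASS OF ONE TRANSPOSITION PRIME
# `q ≡ 1 (mod 4)` AND THE RECIPROCITY LAW AT `p = 2` ON `0 < Δ`

Seat `cruxlead-stmt-BirchSwinnertonDyer-19573-w2` (prover WIDTH under the lead cruxlead-19573 g5; HOME
`run/shared/lean/pub/bsd-2adic/`; `--supports` stmt-BirchSwinnertonDyer-23967). THEOREMS ONLY (no definition, no named fact,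
no `sorry`, no instance). HONEST FRAMING (cell bsd-2adic): BSD is not proved by any of this; neither the crux nor CoreA⁺ is
proved here.

WHAT. `kolyvaginRankOne_two_posDisc` — the displayed statement (H-K) `KolyvaginRankOneTwo` (`…OmegaRoadDefs` §3; PROVED on
`Δ < 0` by `stub_HK_kolyvaginRankOneTwo`, p668150) with its binder `W.Δ < 0` REPLACED by `0 < W.Δ` and ONE MORE HYPOTHESIS on
the prime, `4 ∣ ((primesEquiv q : Nat.Primes) : ℕ) - 1`, inserted right after `Fr ∈ κ.layerSubgroup n` — the output shape of
(H-C)⁺ `chebotarevTransposition_two_posDisc` (`…ChebotarevTranspositionPosDisc.lean`, this seat). PROOF = p668150's assembly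
VERBATIM with two substitutions: the Kolyvagin package is the lead's `exists_kolyvaginPackage_two_realZero` (p688788: p664682
plus the clause «`0 < Δ → 4 ∣ ℓ − 1 →` every shift `T^[k][c]` of the Kolyvagin class is locally trivial at the real place»,
resting on the cocycle-level vanishing p688002 / p687675 and the coset bookkeeping p687566), and Step 4 is the lead's
`StepFour.convCoeff_eq_zero_of_qTermIdentity_modPTwist_two_of_xinf` (p685843: the archimedean term of Poitou–Tate is killed
on the paired class by `hxinf` instead of on the whole local `H¹` by `Δ < 0`), fed by that clause. Everything else — the
exceptional sets, the exact depth `d ≥ n` (`exists_depth_of_isArithFrobAt`), the local Frobenius transposition, the q-term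
identity `exists_unit_qTermIdentity_transposition`, the unramified avatar `Φ' = S^a ∘ Φ`, the pair transport p664102 — is
unchanged (credit lead g0 and the wave-4 workers).

References: B. Mazur, K. Rubin, Mem. AMS 799 (2004) §1.2, Prop. 1.3.2, §3 [MazurRubin2004]; K. Rubin, *Euler Systems*
(2000) §2.1 (`Hyp(K_∞, T)` (b)), §4.4–4.5 [Rubin2000]; K. Kato, Astérisque 295 (2004) §13 [Kato2004Asterisque]; J. S. Milne,
*Arithmetic Duality Theorems* (2006) I Thm. 4.10 [MilneADT2006]; tree p668150 (parent, verbatim), p688788, p685843.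
-/

set_option linter.dupNamespace false
set_option autoImplicit false

noncomputable section

open scoped NumberField ContRepresentation
open CategoryTheory Function Finset Polynomial
open Field IsDedekindDomain NumberField
open Literature.NumberTheory.GaloisRepresentations
open Literature.NumberTheory.GaloisRepresentations.IsNonarchimedeanLocalField
open Literature.NumberTheory.GaloisCohomology
open Literature.NumberTheory.EllipticCurves
open Literature.NumberTheory.EllipticCurves.Kato2004
open Literature.NumberTheory.EllipticCurves.Kato2004.EulerSystemValues
open Rat.HeightOneSpectrum
open Summit.BirchSwinnertonDyer.Rank1Residual.GaloisImage
open Summit.BirchSwinnertonDyer.BirchSwinnertonDyer.Rank1Residual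
open Summit.BirchSwinnertonDyer.BirchSwinnertonDyer.Rank1Residual.StepsTwoFour

namespace Summit.BirchSwinnertonDyer.BirchSwinnertonDyer.Theorems.SteinbergFibreAtTwo

/-- **(H-K)⁺: Kolyvagin's class of ONE transposition prime `q ≡ 1 (mod 4)` and the reciprocity law at `p = 2` on `0 < Δ`.**
The statement `KolyvaginRankOneTwo` with `W.Δ < 0` replaced by `0 < W.Δ` and the extra hypothesis `4 ∣ ℓ(q) − 1` on the
Chebotarev prime: from a GENUINE `2`-adic class (`IsEulerSystemClassTwo`), for a transposition Frobenius `Fr ∈ Γ^{2ⁿ}` above a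
prime `q ∉ S₁` with `4 ∣ ℓ(q) − 1` and `J ≤ 2^n`, the Poitou–Tate sum for `(κ_q, Ψ)` gives the vanishing of all convolution
coefficients `< J − ε` of `e(U·T^a·N(Φ(Fr)), Ψc(Fr))`. Proof = p668150's assembly with the lead's real-zero package (p688788)
and Step 4 `…_of_xinf` (p685843): at `0 < Δ` the real component of the Kolyvagin cocycle of a prime `ℓ ≡ 1 (mod 4)` vanishes.
[cite: MazurRubin2004, Prop. 1.3.2 and §3] [cite: Rubin2000, Thm. 4.5.4] [cite: MilneADT2006, Ch. I, Thm. 4.10] -/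
theorem kolyvaginRankOne_two_posDisc :
    ∀ (W : WeierstrassCurve ℚ) [W.IsElliptic] [W.IsGloballyMinimal]
      [ContinuousSMul ℤ_[2] (W.tateModule 2)] [Module.Free ℤ_[2] (W.tateModule 2)]
      [Module.Finite ℤ_[2] (W.tateModule 2)]
      (κ : ZpExtension ℚ 2) (γ : absoluteGaloisGroup ℚ) (I : IwasawaH1Data W 2 κ γ) (hκ : κ.IsCyclotomic),
      W.HasSurjectiveModNGaloisRep 2 → 0 < W.Δ → κ.IsTopGenerator γ →
      poitouTate_sum_localTatePairing_eq_zero ℚ →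
      ∀ (s : I.H), IsEulerSystemClassTwo W hκ I s →
      ∃ (S₀ : Set (HeightOneSpectrum (𝓞 ℚ))), S₀.Finite ∧
        ∀ (a : ℕ) (κ' : κ.twistTower (W.torsionGaloisModule (2 : ℤ))
            (fun P : WeierstrassCurve.geomTorsion W (2 : ℤ) => AddSubgroup.torsionBy.nsmul P)),
          (κ.towerShift (W.torsionGaloisModule (2 : ℤ))
              (fun P : WeierstrassCurve.geomTorsion W (2 : ℤ) => AddSubgroup.torsionBy.nsmul P))^[a]
            κ' = I.redTower s →
          ∀ (J n : ℕ), J ≤ 2 ^ n →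
          ∀ (Φ : contOneCocycles (W.modPTwist 2 κ J).toTopRep),
            oneCocycleClass (W.modPTwist 2 κ J).toTopRep Φ = κ'.1 J →
          ∀ (ε : ℕ) (S₁ : Set (HeightOneSpectrum (𝓞 ℚ)))
            (Ψ : galoisCohomology (W.modPTwist 2 κ.invTwist J) 1)
            (Ψc : contOneCocycles (W.modPTwist 2 κ.invTwist J).toTopRep),
            S₀ ⊆ S₁ →
            oneCocycleClass (W.modPTwist 2 κ.invTwist J).toTopRep Ψc = Ψ →
            (∀ v : HeightOneSpectrum (𝓞 ℚ), v ∉ S₁ →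
              galoisCohomology.localization (W.modPTwist 2 κ.invTwist J) (Sum.inr v) 1 Ψ ∈
                DiscreteGaloisModule.unramifiedSubgroup
                  (GaloisRep.toLocal v (W.modPTwist 2 κ.invTwist J)) 1) →
            (∀ v : HeightOneSpectrum (𝓞 ℚ), v ∈ S₁ →
              galoisCohomology.localization (W.modPTwist 2 κ.invTwist J) (Sum.inr v) 1
                ((κ.invTwist.shiftH1 (W.torsionGaloisModule (2 : ℤ))
                  (fun P : WeierstrassCurve.geomTorsion W (2 : ℤ) => AddSubgroup.torsionBy.nsmul P)
                  J)^[ε] Ψ) = 0) →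
          ∀ (eW : WeierstrassCurve.geomTorsion W (2 : ℤ) → WeierstrassCurve.geomTorsion W (2 : ℤ) →
              AlgebraicClosure ℚ)
            (hμ : ∀ S T, eW S T ^ 2 = 1)
            (hadd₁ : ∀ S₁' S₂' T, eW (S₁' + S₂') T = eW S₁' T * eW S₂' T)
            (hadd₂ : ∀ S T₁ T₂, eW S (T₁ + T₂) = eW S T₁ * eW S T₂),
            (∀ T, eW T T = 1) → (∀ T, (∀ S, eW S T = 1) → T = 0) →
            (∀ (σ : absoluteGaloisGroup ℚ) (S T : WeierstrassCurve.geomTorsion W (2 : ℤ)),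
              σ • eW S T = eW (σ • S) (σ • T)) →
          ∀ (q : HeightOneSpectrum (𝓞 ℚ)), q ∉ S₁ →
          ∀ 𝔓 ∈ q.primesAbove, ∀ (Fr : absoluteGaloisGroup ℚ), IsArithFrobAt (𝓞 ℚ) Fr 𝔓 →
            WeierstrassCurve.galoisRepTorsion W 2 Fr ≠ 1 → WeierstrassCurve.galoisRepTorsion W 2 (Fr * Fr) = 1 →
            Fr ∈ κ.layerSubgroup n → 4 ∣ ((primesEquiv q : Nat.Primes) : ℕ) - 1 →
          ∃ U : Polynomial ℤ, ¬ (((2 : ℕ) : ℤ) ∣ U.coeff 0) ∧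
            ∀ i : ℕ, i + ε < J →
              convCoeff (weilPairingHom W 2 eW hμ hadd₁ hadd₂) J i
                (Polynomial.aeval (shiftEnd (WeierstrassCurve.geomTorsion W (2 : ℤ)) J) U
                  ((shiftEnd (WeierstrassCurve.geomTorsion W (2 : ℤ)) J ^ a)
                    (W.modPTwist 2 κ J Fr (Φ.1 Fr) - Φ.1 Fr)))
                (Ψc.1 Fr) = 0 := by
  intro W _ _ _ _ _ κ γ I hκ h2 hΔ hγ hPTfact s hES
  classical
  haveI : Fact (2 : ℕ).Prime := ⟨Nat.prime_two⟩
  haveI : Finite (WeierstrassCurve.geomTorsion W ((2 : ℕ) : ℤ)) := finite_geomTorsion_of_neZero W 2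
  -- the real-zero package's exceptional set and the bad set of `E[2]`
  obtain ⟨S₀', hS₀'fin, hK⟩ := exists_kolyvaginPackage_two_realZero W κ hκ γ I h2 hES
  obtain ⟨S₀'', hS₀''fin, hS₀''⟩ :=
    TorsionUnramified.exists_finite_isUnramifiedAt_torsionGaloisModule W (K := ℚ) (p := 2) two_ne_zero
  refine ⟨S₀' ∪ S₀'', hS₀'fin.union hS₀''fin, ?_⟩
  intro a κ' hκ' J n hJn Φ hΦ ε S₁ Ψ Ψc hS hΨc hΨur hΨS eW hμ hadd₁ hadd₂ halt hnd hgal q hq 𝔓 h𝔓 Fr hFr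
    hT1 hT hFrn h4
  have hq' : q ∉ S₀' := fun h => hq (hS (Or.inl h))
  have hoff : ∀ v ∉ S₁, ((2 : ℕ) : 𝓞 ℚ) ∉ v.asIdeal ∧ W.HasGoodReductionAt v ∧
      GaloisRep.IsUnramifiedAt v (W.torsionGaloisModule ((2 : ℕ) : ℤ)) :=
    fun v hv => hS₀'' v fun h => hv (hS (Or.inr h))
  obtain ⟨hqp, -, hur⟩ := hoff q hq
  -- the exact depth `d ≥ n` of `Fr`
  obtain ⟨d, hFrd, hFrd'⟩ := exists_depth_of_isArithFrobAt κ hκ hqp h𝔓 hFr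
  have hnd' : n ≤ d := le_depth_of_mem_layerSubgroup κ hFrd' hFrn
  have hJd : J ≤ 2 ^ d := hJn.trans (Nat.pow_le_pow_right two_pos hnd')
  -- the prime `ℓ` of `q`, instances at `q`
  haveI : NeZero ((primesEquiv q : Nat.Primes) : ℕ) := ⟨(primesEquiv q).2.ne_zero⟩
  haveI : Fact (((primesEquiv q : Nat.Primes) : ℕ)).Prime := ⟨(primesEquiv q).2⟩
  haveI : NeZero ((((primesEquiv q : Nat.Primes) : ℕ) : ℕ) : q.adicCompletion ℚ) := by
    haveI := charZero_adicCompletion q; exact NeZero.charZero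
  haveI hN : (rootsOfUnityFixer ℚ ((primesEquiv q : Nat.Primes) : ℕ)).Normal :=
    KolyvaginTwist.normal_rootsOfUnityFixer _
  haveI : CompactSpace (absoluteGaloisGroup ℚ) := absoluteGaloisGroup_compactSpace ℚ
  haveI : (rootsOfUnityFixer ℚ ((primesEquiv q : Nat.Primes) : ℕ)).FiniteIndex :=
    finiteIndex_of_isOpen_of_compactSpace _ (isOpen_rootsOfUnityFixer ℚ _)
  haveI : Fintype (absoluteGaloisGroup ℚ ⧸ rootsOfUnityFixer ℚ ((primesEquiv q : Nat.Primes) : ℕ)) :=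
    Fintype.ofFinite _
  have hℓabs : Ideal.absNorm q.asIdeal = ((primesEquiv q : Nat.Primes) : ℕ) :=
    Literature.NumberTheory.LFunctions.absNorm_asIdeal_eq_primesEquiv q
  haveI : Fact (Ideal.absNorm q.asIdeal).Prime := ⟨by rw [hℓabs]; exact (primesEquiv q).2⟩
  haveI : NeZero ((Ideal.absNorm q.asIdeal : ℕ) : q.adicCompletion ℚ) :=
    ⟨by rw [hℓabs]; exact NeZero.ne _⟩
  haveI : LocallyCompactSpace (absoluteGaloisGroup ℚ) := inferInstance
  haveI : CompactSpace (absoluteGaloisGroup (q.adicCompletion ℚ)) :=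
    absoluteGaloisGroup_compactSpace (q.adicCompletion ℚ)
  haveI : LocallyCompactSpace (absoluteGaloisGroup (Place.Completion (Sum.inr q : Place ℚ))) :=
    (inferInstance : LocallyCompactSpace (absoluteGaloisGroup (q.adicCompletion ℚ)))
  -- the real-zero Kolyvagin package at `q`
  obtain ⟨hI0, c, τq, r, hτq, hgen, hx, hreal, hr, hval⟩ :=
    hK a κ' hκ' d J hJd Φ hΦ q hq' 𝔓 h𝔓 Fr hFr hT hT1 hFrd hFrd'
  -- the local Frobenius `res r`: a transposition, in `Γ^{2ⁿ}`
  obtain ⟨hrr2, hrr1, hrrlayer⟩ :=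
    LocalFrobenius.galoisRepTorsion_absGaloisRestrict_of_isArithFrobAt W κ hur hqp h𝔓 hFr hT hT1 hr
  have hrrn : absGaloisRestrict ℚ (q.adicCompletion ℚ) r ∈ κ.layerSubgroup n := (hrrlayer n).2 hFrn
  -- `2 ∣ N(q) − 1`, `χ̄_{N q}` onto on inertia, `hgen` in the `absNorm` currency
  have hne : ((primesEquiv q : Nat.Primes) : ℕ) ≠ 2 := TameClass.primesEquiv_ne_of_natCast_not_mem hqp
  have hpl : 2 ∣ Ideal.absNorm q.asIdeal - 1 := by
    rw [hℓabs]
    obtain ⟨k, hk⟩ := ((primesEquiv q).2.eq_two_or_odd').resolve_left hne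
    exact ⟨k, by omega⟩
  have hχI : ∀ u : (ZMod (Ideal.absNorm q.asIdeal))ˣ, ∃ t ∈ absInertia (q.adicCompletion ℚ),
      modPCyclotomicCharacterZMod (q.adicCompletion ℚ) (Ideal.absNorm q.asIdeal) t = u := fun u =>
    Rat.exists_mem_absInertia_adicCompletion_modPCyclotomicCharacterZMod_eq_of_absNorm_eq q rfl u
  have hgen' : ∀ u : (ZMod (Ideal.absNorm q.asIdeal))ˣ,
      u ∈ Subgroup.zpowers (modPCyclotomicCharacterZMod (q.adicCompletion ℚ) (Ideal.absNorm q.asIdeal) τq) := by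
    have key : ∀ (m : ℕ) [Fact m.Prime] [NeZero ((m : ℕ) : q.adicCompletion ℚ)],
        m = ((primesEquiv q : Nat.Primes) : ℕ) →
        ∀ u : (ZMod m)ˣ, u ∈ Subgroup.zpowers (modPCyclotomicCharacterZMod (q.adicCompletion ℚ) m τq) := by
      intro m _ _ hm; subst hm; exact hgen
    exact key _ hℓabs
  -- the Weil pairing datum and the Poitou–Tate invariants
  have he := StepFour.weilPairingHom_torsionGaloisModule_smul W 2 eW hμ hadd₁ hadd₂ hgal
  obtain ⟨ι, v₀, w₀, hι, h1⟩ := exists_iota_weilPairingHom_eq_one W 2 eW hμ hadd₁ hadd₂ hnd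
  obtain ⟨inv, hperf, hPT⟩ := hPTfact 2
  -- the Selmer-side clauses of `Ψ = [Ψc]`, and `c` unramified off `S₁ ∪ {q}`
  have hΨ : ∀ v ∉ S₁, galoisCohomology.localization (W.modPTwist 2 κ.invTwist J) (Sum.inr v) 1
      (oneCocycleClass (W.modPTwist 2 κ.invTwist J).toTopRep Ψc) ∈
      DiscreteGaloisModule.unramifiedSubgroup (GaloisRep.toLocal v (W.modPTwist 2 κ.invTwist J)) 1 :=
    fun v hv => by rw [hΨc]; exact hΨur v hv
  have hΨS' : ∀ v ∈ S₁, galoisCohomology.localization (W.modPTwist 2 κ.invTwist J) (Sum.inr v) 1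
      ((κ.invTwist.shiftH1 (W.torsionGaloisModule ((2 : ℕ) : ℤ))
        (fun P : WeierstrassCurve.geomTorsion W ((2 : ℕ) : ℤ) => AddSubgroup.torsionBy.nsmul P) J)^[ε]
        (oneCocycleClass (W.modPTwist 2 κ.invTwist J).toTopRep Ψc)) = 0 := fun v hv => by
    rw [hΨc]; exact hΨS v hv
  have hxS : ∀ v ∉ S₁, v ≠ q → galoisCohomology.localization (W.modPTwist 2 κ J) (Sum.inr v) 1
      (oneCocycleClass (W.modPTwist 2 κ J).toTopRep c) ∈
      DiscreteGaloisModule.unramifiedSubgroup (GaloisRep.toLocal v (W.modPTwist 2 κ J)) 1 :=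
    fun v hv hvq => hx v hvq (hoff v hv).1 (hoff v hv).2.2
  -- STEP 4 (archimedean term killed ON THE KOLYVAGIN CLASS: `0 < Δ`, `4 ∣ ℓ − 1`) ⊕ the q-term identity, at `(c, τq, r)`
  have h4' : ∀ i, i + ε < J →
      convCoeff (weilPairingHom W 2 eW hμ hadd₁ hadd₂) J i
        (c.1 (absGaloisRestrict ℚ (q.adicCompletion ℚ) τq))
        (Ψc.1 (absGaloisRestrict ℚ (q.adicCompletion ℚ) r)) = 0 := by
    -- the q-term identity at the transposition prime (wave 4, M3) …
    obtain ⟨u, hu0, hu⟩ := exists_unit_qTermIdentity_transposition W κ J eW hμ hadd₁ hadd₂ halt hnd hgal q ι hι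
      hur hqp hpl hχI hr hrr1 hrr2 hJn hrrn hτq hgen' inv hperf
    -- … fed to STEP 4 with the real place killed on `[c]` and its shifts by the package's real-zero clause
    exact StepFour.convCoeff_eq_zero_of_qTermIdentity_modPTwist_two_of_xinf W κ eW hμ hadd₁ hadd₂ hgal hPT J S₁ q hq
      (fun v hv => (hoff v hv).1) (fun v hv => (hoff v hv).2.2) c (hreal hΔ h4) hxS Ψc hΨ ε hΨS' τq r
      (AddMonoidHom.id (ZMod 2)) ι hι u hu0 (fun k hk => hu c Ψc (hΨ q hq) ε k hk)
  -- the unramified avatar `Φ' = S^a ∘ Φ` of `(I.redTower s)_J`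
  set Φ' := κ.shiftPowCocycle (W.torsionGaloisModule ((2 : ℕ) : ℤ))
    (fun P : WeierstrassCurve.geomTorsion W ((2 : ℕ) : ℤ) => AddSubgroup.torsionBy.nsmul P) J a Φ with hΦ'def
  have hΦ'cl : oneCocycleClass (W.modPTwist 2 κ J).toTopRep Φ' = (I.redTower s).1 J := by
    change oneCocycleClass (κ.twistModP (W.torsionGaloisModule ((2 : ℕ) : ℤ))
      (fun P : WeierstrassCurve.geomTorsion W ((2 : ℕ) : ℤ) => AddSubgroup.torsionBy.nsmul P) J).toTopRep
      (κ.shiftPowCocycle (W.torsionGaloisModule ((2 : ℕ) : ℤ))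
        (fun P : WeierstrassCurve.geomTorsion W ((2 : ℕ) : ℤ) => AddSubgroup.torsionBy.nsmul P) J a Φ) = _
    rw [← ZpExtension.shiftH1_iterate_oneCocycleClass, ← hκ', ZpExtension.towerShift_iterate_apply_coe]
    exact congrArg _ hΦ
  have hΦ'I : ∀ i ∈ absInertia (q.adicCompletion ℚ), Φ'.1 (absGaloisRestrict ℚ (q.adicCompletion ℚ) i) = 0 :=
    fun i hi => StepFour.apply_absGaloisRestrict_eq_zero_of_localization_mem_unramified κ
      (W.torsionGaloisModule ((2 : ℕ) : ℤ)) (fun P => AddSubgroup.torsionBy.nsmul P) J q hur hqp Φ'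
      (by rw [← hΦ'cl] at hI0; exact hI0) hi
  have hΨI : ∀ i ∈ absInertia (q.adicCompletion ℚ), Ψc.1 (absGaloisRestrict ℚ (q.adicCompletion ℚ) i) = 0 :=
    fun i hi => StepFour.apply_absGaloisRestrict_eq_zero_of_localization_mem_unramified κ.invTwist
      (W.torsionGaloisModule ((2 : ℕ) : ℤ)) (fun P => AddSubgroup.torsionBy.nsmul P) J q hur hqp Ψc
      (hΨ q hq) hi
  -- `S^a` commutes with the twisted action: `(res r)·Φ'(res r) − Φ'(res r) = S^a((res r)·Φ(res r) − Φ(res r))`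
  have hshift : ∀ (g : absoluteGaloisGroup ℚ),
      W.modPTwist 2 κ J g (Φ'.1 g) - Φ'.1 g =
        (shiftEnd (WeierstrassCurve.geomTorsion W ((2 : ℕ) : ℤ)) J ^ a) (W.modPTwist 2 κ J g (Φ.1 g) - Φ.1 g) := by
    intro g
    rw [hΦ'def, ZpExtension.shiftPowCocycle_apply, map_sub, modPTwist_shiftEnd_pow_apply]
  -- the pair statement at the local Frobenius `r`, with `U = 1`, `m = 0`
  have hloc : ∃ U : ℤ[X], ¬ (2 : ℤ) ∣ U.coeff 0 ∧ ∀ i, i + ε < J →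
      convCoeff (weilPairingHom W 2 eW hμ hadd₁ hadd₂) J i
        (aeval (shiftEnd (WeierstrassCurve.geomTorsion W (2 : ℤ)) J) U
          ((shiftEnd (WeierstrassCurve.geomTorsion W (2 : ℤ)) J ^ 0)
            (W.modPTwist 2 κ J (absGaloisRestrict ℚ (q.adicCompletion ℚ) r)
                (Φ'.1 (absGaloisRestrict ℚ (q.adicCompletion ℚ) r)) -
              Φ'.1 (absGaloisRestrict ℚ (q.adicCompletion ℚ) r))))
        (Ψc.1 (absGaloisRestrict ℚ (q.adicCompletion ℚ) r)) = 0 := by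
    refine ⟨1, by simp, fun i hi => ?_⟩
    rw [map_one, Module.End.one_apply, pow_zero, Module.End.one_apply, hshift, ← hval]
    exact h4' i hi
  -- equivariance of the Weil pairing in the `•` spelling, trivial action on `μ₂`, and the transport to `(𝔓, Fr)`
  have he' : ∀ (g : absoluteGaloisGroup ℚ) (m m' : WeierstrassCurve.geomTorsion W ((2 : ℕ) : ℤ)),
      weilPairingHom W 2 eW hμ hadd₁ hadd₂ (g • m) (g • m') =
        DiscreteGaloisModule.mu ℚ 2 g (weilPairingHom W 2 eW hμ hadd₁ hadd₂ m m') := fun g m m' => by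
    rw [← WeierstrassCurve.torsionGaloisModule_apply_apply, ← WeierstrassCurve.torsionGaloisModule_apply_apply]
    exact he g m m'
  have hP : ∀ (g : absoluteGaloisGroup ℚ) (z : DiscreteGaloisModule.MuCarrier ℚ 2),
      DiscreteGaloisModule.mu ℚ 2 g z = z := fun g z => WeierstrassCurve.mu_two_apply_eq g z
  obtain ⟨U', hU'0, hU'⟩ :=
    StepsTwoFourTransport.exists_forall_convCoeff_aeval_frobSub_eq_zero_of_isAbsArithFrob W κ
      (DiscreteGaloisModule.mu ℚ 2) he' hP hJn Φ' Ψc hqp hur hΦ'I hΨI hr hloc h𝔓 hFr hT hFrn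
  refine ⟨U', hU'0, fun i hi => ?_⟩
  have h := hU' i hi
  rw [pow_zero, Module.End.one_apply, hshift] at h
  exact h

end Summit.BirchSwinnertonDyer.BirchSwinnertonDyer.Theorems.SteinbergFibreAtTwo

end
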